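import Summits.QuantumFields.BalabanUV.T4Continuum.Support.NE3LineAverageSmoothing
import Summits.QuantumFields.BalabanUV.T4Continuum.Support.NE3SquaredTentBump
import HarnessLib

/-!
# T⁴ programme, node NE3 — census R32 (exact half, step 2c): THE SMOOTH BLOCK-MEAN-EXACT INTERPOLANT — exact block sums, Dirichlet energy
# `O(M^{d−2})·Σ|dm|²` AND flat-Laplacian energy `O(M^{d−4})·Σ|dm|²` (the `C¹` competitor the (1.38)-exact sector asks for)

Cell `pub-balaban-gaps` (track G2, seat `ne3`; writer prover-pub-balaban-gaps-ne3-g6-0, 2026-08-23), census `run/shared/lean/pub/pub-balaban-gaps/ne/NE3.md`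
§4 R32.  WHY.  `SlicB8LandauReduction.sum_nhsNormSq_gaugeDir_le_of_isLandauB8` (p363714) bounds the exact part of a (1.38)-Landau direction by
`2·Σ‖D ũ‖² + 32·M²·Σ‖Δ ũ‖²` for ANY competitor `ũ` with the same nested block means; to close the flat (P♮) on B8's slice `slicB8` for every
torus size `N` one needs a competitor whose flat LAPLACIAN is `O(M^{(d−4)/2})·|∇q|` — a `C¹` interpolant.  THIS FILE builds it from tree parts:
SMOOTH any `(M·N)`-periodic field `u` by the box average `boxAvg M` of `NE3LineAverageSmoothing` and RESTORE its block sums with the squared-tent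
bump of `NE3SquaredTentBump`:
  `smoothCoef M u z := (tentSum2 d M)⁻¹ • Σ_{v∈[0,M)^d} (u − boxAvg M u)(M•z + v)`,  **`smoothen M u := boxAvg M u + bump2 M (smoothCoef M u)`**.
(§1) periodicity and **`sum_block_smoothen`** (`Σ_{v} smoothen M u (M•z + v) = Σ_{v} u (M•z + v)` — block sums untouched); (§2) the costs,
with `G = Σ_{y∈periodBox (M·N)} Σ_α ‖dPot u y α‖²`: **`sum_normSq_smoothCoef_le`** (`Σ_z ‖smoothCoef‖² ≤ 2^{d+1}·4096^d·(M²∕M^d)·G`, from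
`‖u − boxAvg u‖² ≤ 2^{d+1}M²G` and `tentSum2 ≥ (M∕64)^d`), **`sum_normSq_dPot_smoothen_le`** (`Σ‖dPot (smoothen u)‖² ≤ (2 + d·2^{d+4}·4096^d)·G`)
and **`sum_normSq_lap_smoothen_le`** (`Σ_y ‖Σ_μ (dPot (smoothen u) y μ − dPot (smoothen u) (y − e_μ) μ)‖² ≤ (8d + 288·d²·2^{d+1}·4096^d)·G∕M²`
— THE `C¹` GAIN: the flat Laplacian costs first differences over `M²`); (§3) fed with the tree's block-mean-exact interpolant
`NE3BlockMeanExactInterpolant.bmeInterp M m` of an `N`-periodic coarse datum `m` (`G ≤ C_bme·(M^d∕M²)·Σ_z Σ_α ‖dPot m z α‖²`,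
`C_bme = 2^{d+1} + 2d²·256^d`): **`smoothInterp M m := smoothen M (bmeInterp M m)`**, `smoothInterp_add_period`, **`sum_block_smoothInterp`**
(`= (M:ℝ)^d • m z` — EXACT block means), **`sum_normSq_dPot_smoothInterp_le`** (`≤ C₁(d)·(M^d∕M²)·Σ|dm|²`) and **`sum_normSq_lap_smoothInterp_le`**
(`≤ C₂(d)·(M^d∕M⁴)·Σ|dm|²`), constants `C₁ = (2 + d·2^{d+4}·4096^d)·C_bme`, `C₂ = (8d + 288·d²·2^{d+1}·4096^d)·C_bme` — astronomically large,
honest, `k`-FREE and `N`-FREE.  Consumed by `Spine/NE3/SlicePoincareSlicB8FlatAllN` (the flat (P♮) on `slicB8` for every `N`).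

CONTENT ([folklore] lattice calculus; 0 sorry; DATA defs `smoothCoef`, `smoothen`, `smoothInterp`), `𝔸` a real normed ring-module, `M ≥ 2`, `N ≥ 1`.

HONEST FRAMING.  Pure lattice calculus; nothing about Bałaban's minimisers; (P♮) on `slicB8` at `W ≠ 1`, T-E_w and **NE3 are NOT proved** here;
spine PROVED 0∕9; finite T⁴ rung (B)+1 — NOT continuum YM on ℝ⁴, NOT infinite volume, NOT mass gap, NOT Clay.
PLACEMENT: `Summits/QuantumFields/BalabanUV/T4Continuum/Support/`.
-/

set_option autoImplicit false

open scoped BigOperators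
open Finset

namespace Summit.QuantumFields.BalabanUV.T4Continuum.NE3SmoothBlockMeanInterpolant

open Literature.MathematicalPhysics.QuantumFieldTheory.Balaban1983to89
open B7Prop1Explicit
open T4AveragingDeficitWallBoundary (periodBox mem_periodBox card_periodBox sum_periodBox_shift)
open SmoothRefineBlocks (blk res)
open NE3BlockLineAverage (sum_periodBox_blocks)
open NE3TangentNoGoWords (dPot)
open NE3CoarseInterpolant (blk_block)
open NE3BlockMeanExactInterpolant (normSq_sum_le_card_mul bmeInterp bmeInterp_add_period sum_block_bmeInterp sum_normSq_dPot_bmeInterp_le)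
open NE3LineAverageSmoothing (boxAvg boxAvg_add_period sum_normSq_dPot_boxAvg_le sum_normSq_lap_boxAvg_le sum_normSq_sub_boxAvg_le)
open NE3SquaredTentBump (tentSum2 le_tentSum2 tentSum2_pos bump2 bump2_add_period sum_block_bump2 sum_normSq_dPot_bump2_le
  sum_normSq_lap_bump2_le)

noncomputable section

variable {d : ℕ}
variable {𝔸 : Type*} [NormedRing 𝔸] [NormedSpace ℝ 𝔸]

/-! ## §1 Smoothing with the block sums restored -/

/-- THE BLOCK-SUM DEFECT COEFFICIENT of block `z`: `(tentSum2 d M)⁻¹ • Σ_{v∈[0,M)^d} (u − boxAvg M u)(M•z + v)`. [folklore] -/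
def smoothCoef (M : ℕ) (u : Site d → 𝔸) (z : Site d) : 𝔸 :=
  (tentSum2 d M)⁻¹ • ∑ v ∈ periodBox (d := d) M, (u ((M : ℤ) • z + v) - boxAvg M u ((M : ℤ) • z + v))

/-- **THE SMOOTHED FIELD WITH ITS BLOCK SUMS RESTORED**: `smoothen M u = boxAvg M u + bump2 M (smoothCoef M u)`. [folklore] -/
def smoothen (M : ℕ) (u : Site d → 𝔸) (y : Site d) : 𝔸 := boxAvg M u y + bump2 M (smoothCoef M u) y

/-- A coarse shift of the block corner is a period shift of the fine site. [folklore] -/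
theorem corner_shift (M N : ℕ) (z v : Site d) (τ : Fin d) :
    (M : ℤ) • (z + (N : ℤ) • e τ) + v = ((M : ℤ) • z + v) + ((M * N : ℕ) : ℤ) • e τ := by
  rw [smul_add, smul_smul]; push_cast; abel

/-- The defect coefficient of an `(M·N)`-periodic field is `N`-periodic. [folklore] -/
theorem smoothCoef_add_period (M : ℕ) {N : ℕ} {u : Site d → 𝔸}
    (hu : ∀ (y : Site d) (τ : Fin d), u (y + ((M * N : ℕ) : ℤ) • e τ) = u y) (z : Site d) (τ : Fin d) :
    smoothCoef M u (z + (N : ℤ) • e τ) = smoothCoef M u z := by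
  unfold smoothCoef
  congr 1
  refine Finset.sum_congr rfl fun v _ => ?_
  rw [corner_shift, hu, boxAvg_add_period M hu]

/-- **PERIODICITY**: `smoothen M u` is `(M·N)`-periodic for `(M·N)`-periodic `u` (`M ≥ 1`). [folklore] -/
theorem smoothen_add_period {M : ℕ} (hM : 1 ≤ M) {N : ℕ} {u : Site d → 𝔸}
    (hu : ∀ (y : Site d) (τ : Fin d), u (y + ((M * N : ℕ) : ℤ) • e τ) = u y) (y : Site d) (τ : Fin d) :
    smoothen M u (y + ((M * N : ℕ) : ℤ) • e τ) = smoothen M u y := by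
  unfold smoothen
  rw [boxAvg_add_period M hu, bump2_add_period hM (smoothCoef_add_period M hu)]

/-- **BLOCK SUMS ARE UNTOUCHED**: `Σ_{v∈[0,M)^d} smoothen M u (M•z + v) = Σ_{v∈[0,M)^d} u (M•z + v)` (`M ≥ 2`). [folklore] -/
theorem sum_block_smoothen {M : ℕ} (hM : 2 ≤ M) (u : Site d → 𝔸) (z : Site d) :
    ∑ v ∈ periodBox (d := d) M, smoothen M u ((M : ℤ) • z + v) = ∑ v ∈ periodBox (d := d) M, u ((M : ℤ) • z + v) := by
  have hM1 : 1 ≤ M := by omega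
  have hT : tentSum2 d M ≠ 0 := (tentSum2_pos hM d).ne'
  unfold smoothen
  rw [Finset.sum_add_distrib, sum_block_bump2 hM1, smoothCoef, smul_smul, mul_inv_cancel₀ hT, one_smul, Finset.sum_sub_distrib]
  abel

/-! ## §2 The costs: defect, Dirichlet energy, flat Laplacian -/

/-- **THE COST OF THE DEFECT**: `Σ_{z∈periodBox N} ‖smoothCoef M u z‖² ≤ 2^{d+1}·4096^d·(M²∕M^d)·Σ_{y∈periodBox (M·N)} Σ_α ‖dPot u y α‖²`
(`M ≥ 2`, `N ≥ 1`, `u` `(M·N)`-periodic). [folklore] -/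
theorem sum_normSq_smoothCoef_le {M N : ℕ} (hM : 2 ≤ M) (hN : 1 ≤ N) {u : Site d → 𝔸}
    (hu : ∀ (y : Site d) (τ : Fin d), u (y + ((M * N : ℕ) : ℤ) • e τ) = u y) :
    ∑ z ∈ periodBox (d := d) N, ‖smoothCoef M u z‖ ^ 2
      ≤ (2 : ℝ) ^ (d + 1) * (4096 : ℝ) ^ d * ((M : ℝ) ^ 2 / (M : ℝ) ^ d)
          * ∑ y ∈ periodBox (d := d) (M * N), ∑ α : Fin d, ‖dPot u y α‖ ^ 2 := by
  have hM1 : 1 ≤ M := by omega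
  have hM0 : (0 : ℝ) < M := by exact_mod_cast (by omega : 0 < M)
  have hMN : 1 ≤ M * N := Nat.one_le_iff_ne_zero.mpr (Nat.mul_ne_zero (by omega) (by omega))
  set G : ℝ := ∑ y ∈ periodBox (d := d) (M * N), ∑ α : Fin d, ‖dPot u y α‖ ^ 2 with hG
  have hG0 : 0 ≤ G := Finset.sum_nonneg fun _ _ => Finset.sum_nonneg fun _ _ => sq_nonneg _
  have hT0 : 0 < tentSum2 d M := tentSum2_pos hM d
  have hTle : ((M : ℝ) / 64) ^ d ≤ tentSum2 d M := le_tentSum2 hM d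
  -- pointwise: `‖coef z‖² ≤ T⁻²·M^d·Σ_v ‖(u − Au)(M z + v)‖²`
  have hpt : ∀ z : Site d, ‖smoothCoef M u z‖ ^ 2
      ≤ (tentSum2 d M)⁻¹ ^ 2 * ((M : ℝ) ^ d * ∑ v ∈ periodBox (d := d) M, ‖u ((M : ℤ) • z + v) - boxAvg M u ((M : ℤ) • z + v)‖ ^ 2) := by
    intro z
    unfold smoothCoef
    rw [norm_smul, mul_pow, Real.norm_of_nonneg (inv_nonneg.mpr hT0.le)]
    refine mul_le_mul_of_nonneg_left ?_ (by positivity)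
    have h := normSq_sum_le_card_mul (periodBox (d := d) M) (fun v => u ((M : ℤ) • z + v) - boxAvg M u ((M : ℤ) • z + v))
    rw [card_periodBox] at h
    push_cast at h
    exact h
  have hdisp := sum_normSq_sub_boxAvg_le (M := M) hM1 hMN hu
  have hblocks : ∑ z ∈ periodBox (d := d) N, ∑ v ∈ periodBox (d := d) M, ‖u ((M : ℤ) • z + v) - boxAvg M u ((M : ℤ) • z + v)‖ ^ 2
      = ∑ y ∈ periodBox (d := d) (M * N), ‖u y - boxAvg M u y‖ ^ 2 :=
    sum_periodBox_blocks M N hM1 (fun y => ‖u y - boxAvg M u y‖ ^ 2)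
  -- `T⁻² ≤ (64/M)^{2d} = 4096^d / M^{2d}`
  have hTinv : (tentSum2 d M)⁻¹ ^ 2 ≤ (4096 : ℝ) ^ d / ((M : ℝ) ^ d) ^ 2 := by
    have h1 : (tentSum2 d M)⁻¹ ≤ (((M : ℝ) / 64) ^ d)⁻¹ := by
      rw [inv_le_inv₀ hT0 (by positivity)]; exact hTle
    calc (tentSum2 d M)⁻¹ ^ 2 ≤ ((((M : ℝ) / 64) ^ d)⁻¹) ^ 2 := pow_le_pow_left₀ (inv_nonneg.mpr hT0.le) h1 2
      _ = (4096 : ℝ) ^ d / ((M : ℝ) ^ d) ^ 2 := by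
          rw [div_pow, inv_div, div_pow, ← pow_mul, show (64 : ℝ) ^ (d * 2) = 4096 ^ d by rw [mul_comm, pow_mul]; norm_num]
  calc ∑ z ∈ periodBox (d := d) N, ‖smoothCoef M u z‖ ^ 2
      ≤ ∑ z ∈ periodBox (d := d) N, (tentSum2 d M)⁻¹ ^ 2 * ((M : ℝ) ^ d
          * ∑ v ∈ periodBox (d := d) M, ‖u ((M : ℤ) • z + v) - boxAvg M u ((M : ℤ) • z + v)‖ ^ 2) :=
        Finset.sum_le_sum fun z _ => hpt z
    _ = (tentSum2 d M)⁻¹ ^ 2 * (M : ℝ) ^ d * ∑ y ∈ periodBox (d := d) (M * N), ‖u y - boxAvg M u y‖ ^ 2 := by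
        rw [← hblocks, Finset.mul_sum]
        exact Finset.sum_congr rfl fun z _ => by ring
    _ ≤ ((4096 : ℝ) ^ d / ((M : ℝ) ^ d) ^ 2) * (M : ℝ) ^ d * ((2 : ℝ) ^ (d + 1) * (M : ℝ) ^ 2 * G) := by
        have h0 : 0 ≤ ∑ y ∈ periodBox (d := d) (M * N), ‖u y - boxAvg M u y‖ ^ 2 := Finset.sum_nonneg fun _ _ => sq_nonneg _
        gcongr
    _ = (2 : ℝ) ^ (d + 1) * (4096 : ℝ) ^ d * ((M : ℝ) ^ 2 / (M : ℝ) ^ d) * G := by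
        field_simp

/-- **THE DIRICHLET ENERGY OF THE SMOOTHED FIELD**: `Σ_y Σ_α ‖dPot (smoothen M u) y α‖² ≤ (2 + d·2^{d+4}·4096^d)·Σ_y Σ_α ‖dPot u y α‖²`. [folklore] -/
theorem sum_normSq_dPot_smoothen_le {M N : ℕ} (hM : 2 ≤ M) (hN : 1 ≤ N) {u : Site d → 𝔸}
    (hu : ∀ (y : Site d) (τ : Fin d), u (y + ((M * N : ℕ) : ℤ) • e τ) = u y) :
    ∑ y ∈ periodBox (d := d) (M * N), ∑ α : Fin d, ‖dPot (smoothen M u) y α‖ ^ 2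
      ≤ (2 + (d : ℝ) * (2 : ℝ) ^ (d + 4) * (4096 : ℝ) ^ d) * ∑ y ∈ periodBox (d := d) (M * N), ∑ α : Fin d, ‖dPot u y α‖ ^ 2 := by
  have hM1 : 1 ≤ M := by omega
  have hM0 : (0 : ℝ) < M := by exact_mod_cast (by omega : 0 < M)
  have hMN : 1 ≤ M * N := Nat.one_le_iff_ne_zero.mpr (Nat.mul_ne_zero (by omega) (by omega))
  set G : ℝ := ∑ y ∈ periodBox (d := d) (M * N), ∑ α : Fin d, ‖dPot u y α‖ ^ 2 with hG
  have hG0 : 0 ≤ G := Finset.sum_nonneg fun _ _ => Finset.sum_nonneg fun _ _ => sq_nonneg _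
  have hpt : ∀ (y : Site d) (α : Fin d), ‖dPot (smoothen M u) y α‖ ^ 2
      ≤ 2 * ‖dPot (boxAvg M u) y α‖ ^ 2 + 2 * ‖dPot (bump2 M (smoothCoef M u)) y α‖ ^ 2 := by
    intro y α
    have hsplit : dPot (smoothen M u) y α = dPot (boxAvg M u) y α + dPot (bump2 M (smoothCoef M u)) y α := by
      simp only [dPot, smoothen]; abel
    rw [hsplit]
    have h := norm_add_le (dPot (boxAvg M u) y α) (dPot (bump2 M (smoothCoef M u)) y α)
    nlinarith [sq_nonneg (‖dPot (boxAvg M u) y α‖ - ‖dPot (bump2 M (smoothCoef M u)) y α‖), norm_nonneg (dPot (boxAvg M u) y α),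
      norm_nonneg (dPot (bump2 M (smoothCoef M u)) y α), norm_nonneg (dPot (boxAvg M u) y α + dPot (bump2 M (smoothCoef M u)) y α)]
  have hA := sum_normSq_dPot_boxAvg_le (M := M) hM1 hMN hu
  have hB := sum_normSq_dPot_bump2_le (d := d) hM1 N (smoothCoef M u)
  have hC := sum_normSq_smoothCoef_le hM hN hu
  calc ∑ y ∈ periodBox (d := d) (M * N), ∑ α : Fin d, ‖dPot (smoothen M u) y α‖ ^ 2
      ≤ ∑ y ∈ periodBox (d := d) (M * N), ∑ α : Fin d,
          (2 * ‖dPot (boxAvg M u) y α‖ ^ 2 + 2 * ‖dPot (bump2 M (smoothCoef M u)) y α‖ ^ 2) :=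
        Finset.sum_le_sum fun y _ => Finset.sum_le_sum fun α _ => hpt y α
    _ = 2 * ∑ y ∈ periodBox (d := d) (M * N), ∑ α : Fin d, ‖dPot (boxAvg M u) y α‖ ^ 2
          + 2 * ∑ y ∈ periodBox (d := d) (M * N), ∑ α : Fin d, ‖dPot (bump2 M (smoothCoef M u)) y α‖ ^ 2 := by
        simp only [Finset.sum_add_distrib, Finset.mul_sum]
    _ ≤ 2 * G + 2 * (4 * (d : ℝ) * ((M : ℝ) ^ d / (M : ℝ) ^ 2)
          * ((2 : ℝ) ^ (d + 1) * (4096 : ℝ) ^ d * ((M : ℝ) ^ 2 / (M : ℝ) ^ d) * G)) :=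
        add_le_add (mul_le_mul_of_nonneg_left hA (by norm_num))
          (mul_le_mul_of_nonneg_left (hB.trans (mul_le_mul_of_nonneg_left hC (by positivity))) (by norm_num))
    _ = (2 + (d : ℝ) * (2 : ℝ) ^ (d + 4) * (4096 : ℝ) ^ d) * G := by
        field_simp
        ring

/-- **THE FLAT LAPLACIAN OF THE SMOOTHED FIELD COSTS FIRST DIFFERENCES OVER `M²`** (the `C¹` gain):
`Σ_y ‖Σ_μ (dPot (smoothen M u) y μ − dPot (smoothen M u) (y − e_μ) μ)‖² ≤ (8d + 288·d²·2^{d+1}·4096^d)∕M² · Σ_y Σ_α ‖dPot u y α‖²`. [folklore] -/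
theorem sum_normSq_lap_smoothen_le {M N : ℕ} (hM : 2 ≤ M) (hN : 1 ≤ N) {u : Site d → 𝔸}
    (hu : ∀ (y : Site d) (τ : Fin d), u (y + ((M * N : ℕ) : ℤ) • e τ) = u y) :
    ∑ y ∈ periodBox (d := d) (M * N), ‖∑ μ : Fin d, (dPot (smoothen M u) y μ - dPot (smoothen M u) (y - e μ) μ)‖ ^ 2
      ≤ (8 * (d : ℝ) + 288 * (d : ℝ) ^ 2 * (2 : ℝ) ^ (d + 1) * (4096 : ℝ) ^ d) / (M : ℝ) ^ 2
          * ∑ y ∈ periodBox (d := d) (M * N), ∑ α : Fin d, ‖dPot u y α‖ ^ 2 := by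
  have hM1 : 1 ≤ M := by omega
  have hM0 : (0 : ℝ) < M := by exact_mod_cast (by omega : 0 < M)
  have hMN : 1 ≤ M * N := Nat.one_le_iff_ne_zero.mpr (Nat.mul_ne_zero (by omega) (by omega))
  set G : ℝ := ∑ y ∈ periodBox (d := d) (M * N), ∑ α : Fin d, ‖dPot u y α‖ ^ 2 with hG
  have hG0 : 0 ≤ G := Finset.sum_nonneg fun _ _ => Finset.sum_nonneg fun _ _ => sq_nonneg _
  set A : Site d → 𝔸 := boxAvg M u with hAdef
  set B : Site d → 𝔸 := bump2 M (smoothCoef M u) with hBdef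
  have hpt : ∀ y : Site d, ‖∑ μ : Fin d, (dPot (smoothen M u) y μ - dPot (smoothen M u) (y - e μ) μ)‖ ^ 2
      ≤ 2 * ‖∑ μ : Fin d, (dPot A y μ - dPot A (y - e μ) μ)‖ ^ 2 + 2 * ‖∑ μ : Fin d, (dPot B y μ - dPot B (y - e μ) μ)‖ ^ 2 := by
    intro y
    have hsplit : ∑ μ : Fin d, (dPot (smoothen M u) y μ - dPot (smoothen M u) (y - e μ) μ)
        = ∑ μ : Fin d, (dPot A y μ - dPot A (y - e μ) μ) + ∑ μ : Fin d, (dPot B y μ - dPot B (y - e μ) μ) := by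
      rw [← Finset.sum_add_distrib]
      refine Finset.sum_congr rfl fun μ _ => ?_
      simp only [dPot, smoothen, hAdef, hBdef]; abel
    rw [hsplit]
    set a := ∑ μ : Fin d, (dPot A y μ - dPot A (y - e μ) μ)
    set b := ∑ μ : Fin d, (dPot B y μ - dPot B (y - e μ) μ)
    have h := norm_add_le a b
    nlinarith [sq_nonneg (‖a‖ - ‖b‖), norm_nonneg a, norm_nonneg b, norm_nonneg (a + b)]
  have hA := sum_normSq_lap_boxAvg_le (M := M) hM1 hMN hu
  have hB := sum_normSq_lap_bump2_le (d := d) hM hN (smoothCoef_add_period M hu)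
  have hC := sum_normSq_smoothCoef_le hM hN hu
  calc ∑ y ∈ periodBox (d := d) (M * N), ‖∑ μ : Fin d, (dPot (smoothen M u) y μ - dPot (smoothen M u) (y - e μ) μ)‖ ^ 2
      ≤ ∑ y ∈ periodBox (d := d) (M * N), (2 * ‖∑ μ : Fin d, (dPot A y μ - dPot A (y - e μ) μ)‖ ^ 2
          + 2 * ‖∑ μ : Fin d, (dPot B y μ - dPot B (y - e μ) μ)‖ ^ 2) := Finset.sum_le_sum fun y _ => hpt y
    _ = 2 * ∑ y ∈ periodBox (d := d) (M * N), ‖∑ μ : Fin d, (dPot A y μ - dPot A (y - e μ) μ)‖ ^ 2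
          + 2 * ∑ y ∈ periodBox (d := d) (M * N), ‖∑ μ : Fin d, (dPot B y μ - dPot B (y - e μ) μ)‖ ^ 2 := by
        rw [Finset.sum_add_distrib, ← Finset.mul_sum, ← Finset.mul_sum]
    _ ≤ 2 * (4 * d / (M : ℝ) ^ 2 * G) + 2 * (144 * (d : ℝ) ^ 2 * ((M : ℝ) ^ d / (M : ℝ) ^ 4)
          * ((2 : ℝ) ^ (d + 1) * (4096 : ℝ) ^ d * ((M : ℝ) ^ 2 / (M : ℝ) ^ d) * G)) :=
        add_le_add (mul_le_mul_of_nonneg_left hA (by norm_num))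
          (mul_le_mul_of_nonneg_left (hB.trans (mul_le_mul_of_nonneg_left hC (by positivity))) (by norm_num))
    _ = (8 * (d : ℝ) + 288 * (d : ℝ) ^ 2 * (2 : ℝ) ^ (d + 1) * (4096 : ℝ) ^ d) / (M : ℝ) ^ 2 * G := by
        field_simp
        ring

/-! ## §3 The smooth block-mean-exact interpolant of a coarse datum -/

/-- **THE SMOOTH BLOCK-MEAN-EXACT INTERPOLANT** of the coarse datum `m`: the tree's block-mean-exact interpolant, smoothed by the box
average, block sums restored by the squared-tent bump. [folklore] -/
def smoothInterp (M : ℕ) (m : Site d → 𝔸) (y : Site d) : 𝔸 := smoothen M (bmeInterp M m) y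

/-- **PERIODICITY**: `smoothInterp M m` is `(M·N)`-periodic for `N`-periodic `m` (`M ≥ 1`). [folklore] -/
theorem smoothInterp_add_period {M : ℕ} (hM : 1 ≤ M) {N : ℕ} {m : Site d → 𝔸}
    (hm : ∀ (z : Site d) (τ : Fin d), m (z + (N : ℤ) • e τ) = m z) (y : Site d) (τ : Fin d) :
    smoothInterp M m (y + ((M * N : ℕ) : ℤ) • e τ) = smoothInterp M m y :=
  smoothen_add_period hM (bmeInterp_add_period hM hm) y τ

/-- **EXACT BLOCK MEANS**: `Σ_{v∈[0,M)^d} smoothInterp M m (M•z + v) = (M:ℝ)^d • m z` (`M ≥ 2`). [folklore] -/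
theorem sum_block_smoothInterp {M : ℕ} (hM : 2 ≤ M) (m : Site d → 𝔸) (z : Site d) :
    ∑ v ∈ periodBox (d := d) M, smoothInterp M m ((M : ℤ) • z + v) = ((M : ℝ) ^ d) • m z := by
  unfold smoothInterp
  rw [sum_block_smoothen hM, sum_block_bmeInterp hM]

/-- **(I1) THE DIRICHLET ENERGY OF THE SMOOTH INTERPOLANT** (`M ≥ 2`, `N ≥ 1`, `m` `N`-periodic):
`Σ_{y∈periodBox (M·N)} Σ_α ‖dPot (smoothInterp M m) y α‖² ≤ (2 + d·2^{d+4}·4096^d)·(2^{d+1} + 2d²·256^d)·(M^d∕M²)·Σ_{z∈periodBox N} Σ_α ‖dPot m z α‖²`.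
[folklore] -/
theorem sum_normSq_dPot_smoothInterp_le {M N : ℕ} (hM : 2 ≤ M) (hN : 1 ≤ N) {m : Site d → 𝔸}
    (hm : ∀ (z : Site d) (τ : Fin d), m (z + (N : ℤ) • e τ) = m z) :
    ∑ y ∈ periodBox (d := d) (M * N), ∑ α : Fin d, ‖dPot (smoothInterp M m) y α‖ ^ 2
      ≤ (2 + (d : ℝ) * (2 : ℝ) ^ (d + 4) * (4096 : ℝ) ^ d) * ((2 : ℝ) ^ (d + 1) + 2 * (d : ℝ) ^ 2 * (256 : ℝ) ^ d)
          * ((M : ℝ) ^ d / (M : ℝ) ^ 2) * ∑ z ∈ periodBox (d := d) N, ∑ α : Fin d, ‖dPot m z α‖ ^ 2 := by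
  have hM1 : 1 ≤ M := by omega
  have h1 := sum_normSq_dPot_smoothen_le hM hN (bmeInterp_add_period hM1 hm)
  have h2 := sum_normSq_dPot_bmeInterp_le (𝔸 := 𝔸) hM hN hm
  unfold smoothInterp
  calc ∑ y ∈ periodBox (d := d) (M * N), ∑ α : Fin d, ‖dPot (smoothen M (bmeInterp M m)) y α‖ ^ 2
      ≤ (2 + (d : ℝ) * (2 : ℝ) ^ (d + 4) * (4096 : ℝ) ^ d)
          * ∑ y ∈ periodBox (d := d) (M * N), ∑ α : Fin d, ‖dPot (bmeInterp M m) y α‖ ^ 2 := h1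
    _ ≤ (2 + (d : ℝ) * (2 : ℝ) ^ (d + 4) * (4096 : ℝ) ^ d) * (((2 : ℝ) ^ (d + 1) + 2 * (d : ℝ) ^ 2 * (256 : ℝ) ^ d)
          * ((M : ℝ) ^ d / (M : ℝ) ^ 2) * ∑ z ∈ periodBox (d := d) N, ∑ α : Fin d, ‖dPot m z α‖ ^ 2) :=
        mul_le_mul_of_nonneg_left h2 (by positivity)
    _ = _ := by ring

/-- **(I2) THE FLAT-LAPLACIAN ENERGY OF THE SMOOTH INTERPOLANT** (`M ≥ 2`, `N ≥ 1`, `m` `N`-periodic):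
`Σ_{y∈periodBox (M·N)} ‖Σ_μ (dPot (smoothInterp M m) y μ − dPot (smoothInterp M m) (y − e_μ) μ)‖²
  ≤ (8d + 288·d²·2^{d+1}·4096^d)·(2^{d+1} + 2d²·256^d)·(M^d∕M⁴)·Σ_{z∈periodBox N} Σ_α ‖dPot m z α‖²` — the `M^{d−4}` currency of a `C¹`
interpolant. [folklore] -/
theorem sum_normSq_lap_smoothInterp_le {M N : ℕ} (hM : 2 ≤ M) (hN : 1 ≤ N) {m : Site d → 𝔸}
    (hm : ∀ (z : Site d) (τ : Fin d), m (z + (N : ℤ) • e τ) = m z) :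
    ∑ y ∈ periodBox (d := d) (M * N), ‖∑ μ : Fin d, (dPot (smoothInterp M m) y μ - dPot (smoothInterp M m) (y - e μ) μ)‖ ^ 2
      ≤ (8 * (d : ℝ) + 288 * (d : ℝ) ^ 2 * (2 : ℝ) ^ (d + 1) * (4096 : ℝ) ^ d) * ((2 : ℝ) ^ (d + 1) + 2 * (d : ℝ) ^ 2 * (256 : ℝ) ^ d)
          * ((M : ℝ) ^ d / (M : ℝ) ^ 4) * ∑ z ∈ periodBox (d := d) N, ∑ α : Fin d, ‖dPot m z α‖ ^ 2 := by
  have hM1 : 1 ≤ M := by omega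
  have hM0 : (0 : ℝ) < M := by exact_mod_cast (by omega : 0 < M)
  have h1 := sum_normSq_lap_smoothen_le hM hN (bmeInterp_add_period hM1 hm)
  have h2 := sum_normSq_dPot_bmeInterp_le (𝔸 := 𝔸) hM hN hm
  unfold smoothInterp
  calc ∑ y ∈ periodBox (d := d) (M * N), ‖∑ μ : Fin d, (dPot (smoothen M (bmeInterp M m)) y μ
        - dPot (smoothen M (bmeInterp M m)) (y - e μ) μ)‖ ^ 2
      ≤ (8 * (d : ℝ) + 288 * (d : ℝ) ^ 2 * (2 : ℝ) ^ (d + 1) * (4096 : ℝ) ^ d) / (M : ℝ) ^ 2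
          * ∑ y ∈ periodBox (d := d) (M * N), ∑ α : Fin d, ‖dPot (bmeInterp M m) y α‖ ^ 2 := h1
    _ ≤ (8 * (d : ℝ) + 288 * (d : ℝ) ^ 2 * (2 : ℝ) ^ (d + 1) * (4096 : ℝ) ^ d) / (M : ℝ) ^ 2
          * (((2 : ℝ) ^ (d + 1) + 2 * (d : ℝ) ^ 2 * (256 : ℝ) ^ d)
            * ((M : ℝ) ^ d / (M : ℝ) ^ 2) * ∑ z ∈ periodBox (d := d) N, ∑ α : Fin d, ‖dPot m z α‖ ^ 2) :=
        mul_le_mul_of_nonneg_left h2 (by positivity)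
    _ = _ := by
        field_simp

end

end Summit.QuantumFields.BalabanUV.T4Continuum.NE3SmoothBlockMeanInterpolant
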